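import Summits.CriticalPhenomena.PercolationContinuityZ3.Theorems.PercNearOneGluingNoHeavyQuantPkConstants
import Summits.CriticalPhenomena.PercolationContinuityZ3.Theorems.PercNearOneGluingNoHeavyQuantKnConstantsCertified
import Mathlib.Analysis.Complex.ExponentialBounds
import HarnessLib

/-!
# QUANT lane / PAPER-2 rate track (ARM-1, gen 2), Peierls lever P5e: certified numerals of the `pk`-cascade in `d = 3`
# (Peierls constant `2⁻⁸`)

builds on p205010 (kernel theorem, internal audit signed; external expert review pending)

Cell `prim-quant`, seat `prim-quant-arm-1` (rate-theorem architect), memo `run/shared/lean/prim/quant/RATE-PLAN.md` §11.  The pattern of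
`…QuantKnConstantsCertified.lean` (prim-quant-census-1, p211223) for the constants of `…QuantPkConstants` (`pkEps = 2⁻⁸`):

* `pkK_arg_eq` : the real number inside `⌈·⌉` of `pkK` is `11·log 2·2¹³ = 90112·log 2` (`= 62460.878…`); `pkK_ge_numeral`, `pkK_le_numeral` :
  `62460 ≤ pkK ≤ 62461` (versus `knK ≈ 3.33·10¹²`);
* `pkTau1_three_eq` : `pkTau1 3 = (ε/384)²`; `pkDeltaE_three_eq` : `pkDeltaE 3 = 1/(2¹⁶·29491200·pkK)`; `pkTauU_three_eq` : `pkTauU 3 = 1/(2·(2¹⁶·29491200·pkK)²)`;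
* `pkTauU_three_lt_pow`, `pow_lt_pkTauU_three` : `(1/2)^115 < pkTauU 3 < (1/2)^114` (`log₂ pkTauU 3 = −114.49…`, versus `−261.83` for `kn`);
* `pow_lt_pkTauU_pow_orbit_three`, `pkTauU_pow_orbit_three_lt_pow` : `(1/2)^2760 < pkTauU 3 ^ (3·2³) < (1/2)^2736` — the ORBIT window defect of
  the `pk`-cascade on `ℤ³` is between `2⁻²⁷⁶⁰` and `2⁻²⁷³⁶` (interval arithmetic gives `log₂ = −2747.7`; the tree's `kn` value is `−6283.9`).

So the Peierls lever moves the per-scale defect of the displayed `d = 3` rate from `1 − 2⁻⁶²⁸⁸` (p213333's display uses the certified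
`2⁻⁶²⁸⁴`) to `1 − 2⁻²⁷⁶⁰`: an explicit function tending to `0` and nothing more; class (iterated logarithm) unchanged.  No definitions,
no sorries; standard axioms.  [cite: KozmaNitzan2024, §4 Theorem 6]
-/

noncomputable section

namespace Summit.CriticalPhenomena.PercolationContinuityZ3.Theorems.Quant

open Literature.Probability.Percolation Literature.Probability.LatticeModels
open Literature.Probability.Percolation.GM (HOct)

/-- The real number inside the ceiling of `pkK` is `11·log 2·2¹³`: `log(8/ε)·(32/ε) = log(2¹¹)·2¹³` for `ε = 2⁻⁸`.
builds on p205010 (kernel theorem, internal audit signed; external expert review pending). [folklore] (numeric) -/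
theorem pkK_arg_eq : Real.log (8 / pkEps) * (32 / pkEps) = 90112 * Real.log 2 := by
  have hε : pkEps = (1 / 2) ^ 8 := rfl
  have h8 : (8 : ℝ) / pkEps = 2 ^ 11 := by rw [hε]; norm_num
  have h32 : (32 : ℝ) / pkEps = 2 ^ 13 := by rw [hε]; norm_num
  rw [h8, h32, Real.log_pow]
  push_cast
  ring

/-- **`62460 ≤ pkK`** (from `0.6931471803 < log 2`; exact value `62461`).
builds on p205010 (kernel theorem, internal audit signed; external expert review pending). [folklore] (numeric; `Real.log_two_gt_d9`) -/
theorem pkK_ge_numeral : 62460 ≤ pkK := by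
  unfold pkK
  refine le_max_of_le_right ?_
  have hlog := Real.log_two_gt_d9
  have hx : (62460 : ℝ) ≤ Real.log (8 / pkEps) * (32 / pkEps) := by
    rw [pkK_arg_eq]; norm_num at hlog ⊢; linarith
  have h : ((62460 : ℕ) : ℝ) ≤ (⌈Real.log (8 / pkEps) * (32 / pkEps)⌉₊ : ℝ) := by
    push_cast; exact hx.trans (Nat.le_ceil _)
  exact_mod_cast h

/-- **`pkK ≤ 62461`** (from `log 2 < 0.6931471808`).
builds on p205010 (kernel theorem, internal audit signed; external expert review pending). [folklore] (numeric; `Real.log_two_lt_d9`) -/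
theorem pkK_le_numeral : pkK ≤ 62461 := by
  unfold pkK
  refine max_le (by norm_num) (Nat.ceil_le.2 ?_)
  have hlog := Real.log_two_lt_d9
  rw [pkK_arg_eq]; norm_num at hlog ⊢; linarith

/-- In `d = 3` the finest tolerance is the corridor one: `pkTau1 3 = (pkEps/384)²`.
builds on p205010 (kernel theorem, internal audit signed; external expert review pending). [folklore] -/
theorem pkTau1_three_eq : pkTau1 3 = (pkEps / 384) ^ 2 := by
  unfold pkTau1 pkDelta pkDeltaCorr
  have hε := pkEps_pos
  have hC : pkEps / (96 * (((3 : ℕ) : ℝ) + 1)) = pkEps / 384 := by norm_num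
  rw [hC]
  refine min_eq_right (pow_le_pow_left₀ (by positivity) ?_ 2)
  rw [div_le_div_iff₀ (by norm_num) (by norm_num)]; nlinarith

/-- **`pkDeltaE 3 = 1/(2¹⁶ · 29491200 · pkK)`** (`29491200 = 384²·200`).
builds on p205010 (kernel theorem, internal audit signed; external expert review pending). [folklore] -/
theorem pkDeltaE_three_eq : pkDeltaE 3 = 1 / (2 ^ 16 * 29491200 * (pkK : ℝ)) := by
  unfold pkDeltaE
  rw [pkTau1_three_eq]
  have hε : pkEps = (1 / 2) ^ 8 := rfl
  have hK0 : (0 : ℝ) < pkK := by exact_mod_cast pkK_pos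
  rw [hε]
  field_simp
  norm_num

/-- **`pkTauU 3 = 1/(2 · (2¹⁶ · 29491200 · pkK)²)`**.
builds on p205010 (kernel theorem, internal audit signed; external expert review pending). [folklore] -/
theorem pkTauU_three_eq : pkTauU 3 = 1 / (2 * (2 ^ 16 * 29491200 * (pkK : ℝ)) ^ 2) := by
  unfold pkTauU
  rw [pkDeltaE_three_eq]
  have hK0 : (0 : ℝ) < pkK := by exact_mod_cast pkK_pos
  have hD : (0 : ℝ) < 2 ^ 16 * 29491200 * (pkK : ℝ) := by positivity
  field_simp

/-- **`pkTauU 3 < (1/2)^114`** (`log₂ pkTauU 3 = −114.49…`).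
builds on p205010 (kernel theorem, internal audit signed; external expert review pending). [folklore] (numeric) -/
theorem pkTauU_three_lt_pow : pkTauU 3 < (1 / 2 : ℝ) ^ 114 := by
  rw [pkTauU_three_eq]
  have hK : (62460 : ℝ) ≤ (pkK : ℝ) := by exact_mod_cast pkK_ge_numeral
  have hD : (2 ^ 16 * 29491200 * 62460 : ℝ) ≤ 2 ^ 16 * 29491200 * (pkK : ℝ) := by nlinarith
  have hD0 : (0 : ℝ) < 2 ^ 16 * 29491200 * 62460 := by norm_num
  have hnat : (2 : ℕ) ^ 114 < 2 * (2 ^ 16 * 29491200 * 62460) ^ 2 := by decide +kernel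
  have hnum : (2 : ℝ) ^ 114 < 2 * (2 ^ 16 * 29491200 * 62460 : ℝ) ^ 2 := by
    have h := (Nat.cast_lt (α := ℝ)).mpr hnat
    set_option simprocs false in
    simpa only [Nat.cast_pow, Nat.cast_mul, Nat.cast_ofNat] using h
  have hpos : (0 : ℝ) < 2 * (2 ^ 16 * 29491200 * 62460 : ℝ) ^ 2 := by positivity
  have hle : 2 * (2 ^ 16 * 29491200 * 62460 : ℝ) ^ 2 ≤ 2 * (2 ^ 16 * 29491200 * (pkK : ℝ)) ^ 2 :=
    mul_le_mul_of_nonneg_left (pow_le_pow_left₀ hD0.le hD 2) (by norm_num)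
  have h2 : (0 : ℝ) < (2 : ℝ) ^ 114 := pow_pos (by norm_num) 114
  have h1 : (1 / 2 : ℝ) ^ 114 = 1 / (2 : ℝ) ^ 114 := one_div_pow 2 114
  rw [h1]
  exact (one_div_le_one_div_of_le hpos hle).trans_lt (one_div_lt_one_div_of_lt h2 hnum)

/-- **`(1/2)^115 < pkTauU 3`**.
builds on p205010 (kernel theorem, internal audit signed; external expert review pending). [folklore] (numeric) -/
theorem pow_lt_pkTauU_three : (1 / 2 : ℝ) ^ 115 < pkTauU 3 := by
  rw [pkTauU_three_eq]
  have hK : (pkK : ℝ) ≤ 62461 := by exact_mod_cast pkK_le_numeral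
  have hK0 : (0 : ℝ) < pkK := by exact_mod_cast pkK_pos
  have hD : 2 ^ 16 * 29491200 * (pkK : ℝ) ≤ (2 ^ 16 * 29491200 * 62461 : ℝ) := by nlinarith
  have hnat : 2 * ((2 : ℕ) ^ 16 * 29491200 * 62461) ^ 2 < 2 ^ 115 := by decide +kernel
  have hnum : 2 * (2 ^ 16 * 29491200 * 62461 : ℝ) ^ 2 < (2 : ℝ) ^ 115 := by
    have h := (Nat.cast_lt (α := ℝ)).mpr hnat
    set_option simprocs false in
    simpa only [Nat.cast_pow, Nat.cast_mul, Nat.cast_ofNat] using h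
  have hDK : (0 : ℝ) < 2 ^ 16 * 29491200 * (pkK : ℝ) := by positivity
  have hposK : (0 : ℝ) < 2 * (2 ^ 16 * 29491200 * (pkK : ℝ)) ^ 2 := by positivity
  have hpos : (0 : ℝ) < 2 * (2 ^ 16 * 29491200 * 62461 : ℝ) ^ 2 := by positivity
  have hle : 2 * (2 ^ 16 * 29491200 * (pkK : ℝ)) ^ 2 ≤ 2 * (2 ^ 16 * 29491200 * 62461 : ℝ) ^ 2 :=
    mul_le_mul_of_nonneg_left (pow_le_pow_left₀ hDK.le hD 2) (by norm_num)
  have h1 : (1 / 2 : ℝ) ^ 115 = 1 / (2 : ℝ) ^ 115 := one_div_pow 2 115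
  rw [h1]
  exact (one_div_lt_one_div_of_lt hpos hnum).trans_le (one_div_le_one_div_of_le hposK hle)

/-- **`(1/2)^2760 < pkTauU 3 ^ (3·2^3)`** (`2760 = 115·24`).
builds on p205010 (kernel theorem, internal audit signed; external expert review pending). [folklore] (numeric) -/
theorem pow_lt_pkTauU_pow_orbit_three : (1 / 2 : ℝ) ^ 2760 < pkTauU 3 ^ (3 * 2 ^ 3) := by
  rw [show 3 * 2 ^ 3 = 24 by norm_num, show (2760 : ℕ) = 115 * 24 by norm_num, pow_mul]
  exact pow_lt_pow_left₀ pow_lt_pkTauU_three (by positivity) (by norm_num)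

/-- **`pkTauU 3 ^ (3·2^3) < (1/2)^2736`** (`2736 = 114·24`).
builds on p205010 (kernel theorem, internal audit signed; external expert review pending). [folklore] (numeric) -/
theorem pkTauU_pow_orbit_three_lt_pow : pkTauU 3 ^ (3 * 2 ^ 3) < (1 / 2 : ℝ) ^ 2736 := by
  rw [show 3 * 2 ^ 3 = 24 by norm_num, show (2736 : ℕ) = 114 * 24 by norm_num, pow_mul]
  exact pow_lt_pow_left₀ pkTauU_three_lt_pow (pkTauU_pos 3).le (by norm_num)

/-- `1 − pkTauU 3 ^ 24 ≤ 1 − 2^{-2760}` and `0 ≤ 1 − pkTauU 3 ^ 24`.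
builds on p205010 (kernel theorem, internal audit signed; external expert review pending). [folklore] (numeric) -/
theorem one_sub_pkTauU_pow_orbit_three_le :
    1 - pkTauU 3 ^ (3 * 2 ^ 3) ≤ 1 - (1 / 2 : ℝ) ^ 2760 ∧ 0 ≤ 1 - pkTauU 3 ^ (3 * 2 ^ 3) := by
  refine ⟨sub_le_sub_left pow_lt_pkTauU_pow_orbit_three.le 1, sub_nonneg.2 ?_⟩
  have h1 : pkTauU 3 ≤ 1 := (pkTauU_lt 3).le.trans (by have := pkDeltaE_sq_lt 3; have := pkDeltaE_lt_one 3; nlinarith)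
  exact pow_le_one₀ (pkTauU_pos 3).le h1

end Summit.CriticalPhenomena.PercolationContinuityZ3.Theorems.Quant

end
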